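import Literature.NumberTheory.Automorphic.BrandtModuleSplitLattices
import Literature.NumberTheory.Automorphic.BrandtModuleHecke
import Literature.NumberTheory.Automorphic.QuaternionSubidealCount
import HarnessLib

/-!
# Residually split primes: heredity and the fibre count `p + 1` / `1`

Seventeenth layer of the proof files for the named fact `brandtMatrix_comm` of `BrandtModule.lean`
(Vignéras, LNM 800, III §5 ex. 5.8 (c); Eichler 1973, II §6 Thm. 2 (19)). For a `ℤ`-order `O`
with matrix units modulo `p` (`IsMatrixUnitsMod`, i.e. residually split at `p`) in a definite
(division) quaternion algebra over `ℚ`: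

* `localAt_eq_of_le_sup_smul` — `J ⊆ y O + p J` forces `J_(p) = y O_(p)`;
* `IsMatrixUnitsMod.isInvertibleRightIdeal_of_between` — **heredity at `p`**: a right
  `O`-lattice `J` with `p^n I ⊆ J ⊆ I`, `I` invertible, is an invertible right `O`-ideal
  (`J = y O + p J` by the generator of `BrandtModuleSplitLattices`, so `J_(p) = y O_(p)` is
  principal, and `J` is the glued ideal of `QuaternionSubidealCount`);
* `IsMatrixUnitsMod.card_fibre_of_le` / `card_fibre_of_not_le` — **the fibre count** of the
  Hecke recursion (`BrandtModuleHecke`): over `K ∈ Sub(I, p^{a+1} p)` the invertible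
  `J ∈ Sub(I, p^{a+1})` containing `K` number `p + 1` if `K ⊆ p I` and `1` otherwise (they are the
  right `O`-lattices between `K` and `L = {x ∈ I | p x ∈ K}` of index `p²` over `K`, and
  `[L : K] = p⁴` iff `K ⊆ p I`, else `p²`).

## References

* M. Eichler, LNM 320 (1973), Ch. II §6, proof of Thm. 2 [Eichler1973].
* M.-F. Vignéras, LNM 800 (1980), Ch. II §2 (idéaux de `M₂(ℤ_p)`), Ch. III §5 ex. 5.8 [VignerasLNM800].
* J. Voight, *Quaternion Algebras* (2021), Main Thm. 16.6.1, §26.4 [Voight2021].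
-/

noncomputable section

open scoped Pointwise

universe u

namespace Literature.NumberTheory.Automorphic

variable {B : Type u} [Ring B] [Algebra ℚ B] [IsQuaternionAlgebra ℚ B] {O : Submodule ℤ B} {p : ℕ}

/-! ### Lattices squeezed between `m I` and `I` -/

omit [Algebra ℚ B] [IsQuaternionAlgebra ℚ B] in
/-- A lattice `J` with `m I ⊆ J ⊆ I` (`I` full, `m ≠ 0`) is full. [folklore] -/
theorem isFullLattice_of_between {I J : Submodule ℤ B} (hI : IsFullLattice B I) (hJI : J ≤ I) {m : ℤ}
    (hm : m ≠ 0) (hmI : ∀ x ∈ I, m • x ∈ J) : IsFullLattice B J := by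
  refine ⟨?_, fun d => ?_⟩
  · haveI : Module.Finite ℤ I := Module.Finite.iff_fg.mpr hI.1
    haveI : IsNoetherian ℤ I := inferInstance
    have hfg : (J.comap I.subtype).FG := IsNoetherian.noetherian _
    have : J = (J.comap I.subtype).map I.subtype := by
      rw [Submodule.map_comap_subtype, inf_eq_right.mpr hJI]
    rw [this]
    exact hfg.map _
  · obtain ⟨n, hn, hnd⟩ := hI.2 d
    exact ⟨m * n, mul_ne_zero hm hn, by rw [mul_smul]; exact hmI _ hnd⟩

/-! ### `J ⊆ y O + p J` gives `J_(p) = y O_(p)` -/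

omit [Algebra ℚ B] [IsQuaternionAlgebra ℚ B] in
/-- Iterating `J ⊆ y O + p J`: `J ⊆ y O + p^n J`. [folklore] -/
theorem le_sup_pow_smul_of_le_sup_smul {J : Submodule ℤ B} (y : Bˣ) (h : J ≤ y • O ⊔ (p : ℤ) • J) (n : ℕ) :
    J ≤ y • O ⊔ ((p ^ n : ℕ) : ℤ) • J := by
  induction n with
  | zero => intro x hx; rw [pow_zero, Nat.cast_one, one_smul]; exact le_sup_right (a := y • O) hx
  | succ n ih =>
    intro x hx
    obtain ⟨a, ha, b, hb, rfl⟩ := Submodule.mem_sup.mp (h hx)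
    obtain ⟨j, hj, rfl⟩ := (Submodule.mem_smul_pointwise_iff_exists _ _ J).mp hb
    obtain ⟨a', ha', b', hb', rfl⟩ := Submodule.mem_sup.mp (ih hj)
    obtain ⟨j', hj', rfl⟩ := (Submodule.mem_smul_pointwise_iff_exists _ _ J).mp hb'
    refine Submodule.mem_sup.mpr ⟨a + (p : ℤ) • a', (y • O).add_mem ha ((y • O).smul_mem _ ha'),
      ((p ^ (n + 1) : ℕ) : ℤ) • j', Submodule.smul_mem_pointwise_smul _ _ J hj', ?_⟩
    have : ((p ^ (n + 1) : ℕ) : ℤ) = (p : ℤ) * ((p ^ n : ℕ) : ℤ) := by push_cast; ring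
    rw [this, mul_smul, smul_add]
    abel

omit [Algebra ℚ B] [IsQuaternionAlgebra ℚ B] in
/-- **`J ⊆ y O + p J` gives `J_(p) = y O_(p)`** for a full lattice `J ⊇ y O`: with `d J ⊆ y O`,
`d = p^v d'`, `p ∤ d'`, one gets `d' J ⊆ y O`. [folklore] -/
theorem localAt_eq_of_le_sup_smul (hO : IsZOrder O) (hp : p.Prime) {J : Submodule ℤ B} (hJ : IsFullLattice B J)
    (y : Bˣ) (hyJ : y • O ≤ J) (h : J ≤ y • O ⊔ (p : ℤ) • J) : localAt p J = y • localAt p O := by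
  obtain ⟨d, hd0, hd⟩ := exists_smul_mem_of_fg (hO.isFullLattice.units_smul y) hJ.1
  have hn0 : d.natAbs ≠ 0 := Int.natAbs_ne_zero.mpr hd0
  have hsd : ((d.natAbs : ℕ) : ℤ) = d.sign * d := (Int.sign_mul_self_eq_natAbs d).symm
  have hnJ : ∀ x ∈ J, ((d.natAbs : ℕ) : ℤ) • x ∈ y • O := fun x hx => by
    rw [hsd, mul_smul]
    exact (y • O).smul_mem _ (hd x hx)
  obtain ⟨v, d', hd', hnd⟩ := Nat.exists_eq_pow_mul_and_not_dvd hn0 p hp.ne_one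
  have hd'0 : d' ≠ 0 := fun h0 => hn0 (by rw [hnd, h0, mul_zero])
  have hcop : d'.Coprime p := (Nat.Coprime.symm ((Nat.Prime.coprime_iff_not_dvd hp).mpr hd'))
  rw [mul_comm] at hnd
  rw [← localAt_units_smul]
  refine localAt_eq_of_smul_le hyJ hd'0 hcop fun x hx => ?_
  obtain ⟨a, ha, b, hb, rfl⟩ := Submodule.mem_sup.mp (le_sup_pow_smul_of_le_sup_smul y h v hx)
  obtain ⟨j, hj, rfl⟩ := (Submodule.mem_smul_pointwise_iff_exists _ _ J).mp hb
  rw [smul_add, smul_smul, ← Nat.cast_mul, ← hnd]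
  exact (y • O).add_mem ((y • O).smul_mem _ ha) (hnJ j hj)

/-! ### Heredity at a residually split prime -/

/-- **Heredity at a residually split prime.** In a division quaternion algebra over `ℚ`, let `O`
have matrix units modulo `p`, `I` an invertible right `O`-ideal and `J` a right `O`-lattice
with `p^n I ⊆ J ⊆ I`. Then `J` is an invertible right `O`-ideal. [cite: VignerasLNM800, Ch. II §2 (idéaux de M₂(ℤ_p) principaux); Voight2021, Main Thm. 16.6.1] -/
theorem IsMatrixUnitsMod.isInvertibleRightIdeal_of_between (hdiv : ∀ x : B, x ≠ 0 → IsUnit x)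
    (hO : IsZOrder O) {e u v : B} (hmu : IsMatrixUnitsMod O p e u v) (hp : p.Prime) {I J : Submodule ℤ B}
    (hI : IsInvertibleRightIdeal O I) (hJI : J ≤ I) (hJO : ∀ x ∈ J, ∀ o ∈ O, x * o ∈ J) {n : ℕ}
    (hnI : ∀ x ∈ I, ((p ^ n : ℕ) : ℤ) • x ∈ J) : IsInvertibleRightIdeal O J := by
  haveI : Fact p.Prime := ⟨hp⟩
  have hJfull : IsFullLattice B J :=
    isFullLattice_of_between hI.isFullLattice hJI (by exact_mod_cast pow_ne_zero n hp.ne_zero) hnI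
  obtain ⟨w, hw⟩ := exists_units_eq_natCast (B := B) hp.ne_zero
  -- the pair `(J, p J)`
  set K : Submodule ℤ B := (p : ℤ) • J with hK
  have hpair : IsLatticePair O p J K :=
    { le := zsmul_le _ _
      mul_mem_M := hJO
      mul_mem_K := fun x hx o ho => by
        obtain ⟨j, hj, rfl⟩ := (Submodule.mem_smul_pointwise_iff_exists _ _ J).mp hx
        rw [smul_mul_assoc]
        exact Submodule.smul_mem_pointwise_smul _ _ J (hJO j hj o ho)
      smul_mem := fun x hx => Submodule.smul_mem_pointwise_smul _ _ J hx }
  have hidx : K.toAddSubgroup.relIndex J.toAddSubgroup = p ^ 4 := by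
    rw [hK, ← units_smul_eq_natCast_smul hw]
    exact BrandtModule.relIndex_natCast_units_smul hJfull hw
  obtain ⟨y, hyJ, hgen⟩ := exists_generator_mod hmu hpair hp hidx
  -- `y ≠ 0`
  have hy0 : y ≠ 0 := by
    rintro rfl
    have hKJ : K = J := hgen K le_rfl hpair.le hpair.mul_mem_K K.zero_mem
    rw [hKJ, AddSubgroup.relIndex_self] at hidx
    exact absurd hidx.symm (by
      have : 1 < p ^ 4 := Nat.one_lt_pow (by norm_num) hp.one_lt
      omega)
  set uy : Bˣ := (hdiv y hy0).unit with huy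
  have huyval : (uy : B) = y := rfl
  have huyO : uy • O ≤ J := fun x hx => by
    obtain ⟨o, ho, rfl⟩ := (Submodule.mem_smul_pointwise_iff_exists _ _ O).mp hx
    rw [Units.smul_def, huyval, smul_eq_mul]
    exact hJO y hyJ o ho
  -- `J = y O + p J`
  have hJle : J ≤ uy • O ⊔ K := by
    have hstab : ∀ x ∈ uy • O ⊔ K, ∀ o ∈ O, x * o ∈ uy • O ⊔ K := fun x hx o ho => by
      obtain ⟨a, ha, b, hb, rfl⟩ := Submodule.mem_sup.mp hx
      rw [add_mul]
      refine Submodule.add_mem _ (Submodule.mem_sup_left ?_) (Submodule.mem_sup_right (hpair.mul_mem_K b hb o ho))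
      obtain ⟨o', ho', rfl⟩ := (Submodule.mem_smul_pointwise_iff_exists _ _ O).mp ha
      refine (Submodule.mem_smul_pointwise_iff_exists _ _ O).mpr ⟨o' * o, hO.mul_mem _ ho' _ ho, ?_⟩
      simp only [Units.smul_def, smul_eq_mul, mul_assoc]
    have hyin : y ∈ uy • O ⊔ K := Submodule.mem_sup_left
      ((Submodule.mem_smul_pointwise_iff_exists _ _ O).mpr ⟨1, hO.one_mem, by rw [Units.smul_def, huyval, smul_eq_mul, mul_one]⟩)
    exact (hgen _ le_sup_right (sup_le huyO hpair.le) hstab hyin).ge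
  have hloc : localAt p J = uy • localAt p O := localAt_eq_of_le_sup_smul hO hp hJfull uy huyO hJle
  -- gluing
  obtain ⟨α, -, hα⟩ := hI.exists_localAt_eq_units_smul hdiv hO p
  set z : Bˣ := α⁻¹ * uy with hz
  have hzO : (z : B) ∈ localAt p O := by
    rw [hz, Units.val_mul, ← mem_units_smul_iff_mul_mem, ← hα]
    exact le_localAt p I (hJI hyJ)
  obtain ⟨k, -, hk⟩ := exists_relIndex_units_smul_localAt_eq_pow hO z hzO
  obtain ⟨M, hMinv, hMI, -, hMp, hMq⟩ := exists_subideal_of_localPrincipal hdiv hO hI hα hzO hk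
  have hMJ : M = J := by
    refine eq_iff_forall_prime_localAt_eq.mpr fun q hq => ?_
    by_cases hqp : q = p
    · subst hqp
      rw [hMp, hloc, hz, mul_inv_cancel_left]
    · rw [hMq q hq hqp]
      exact localAt_eq_of_smul_le hJI (pow_ne_zero n hp.ne_zero)
        (Nat.Coprime.pow_left n ((Nat.coprime_primes hp hq).mpr (Ne.symm hqp))) hnI
  exact hMJ ▸ hMinv

/-! ### The lattice `L = {x ∈ I | p x ∈ K}` -/

/-- The lattice `L = {x ∈ I | p x ∈ K}`. [folklore] -/
def divLattice (I K : Submodule ℤ B) (p : ℕ) : Submodule ℤ B :=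
  I ⊓ K.comap (DistribSMul.toLinearMap ℤ B (p : ℤ))

omit [Algebra ℚ B] [IsQuaternionAlgebra ℚ B] in
/-- Membership in `divLattice`. [folklore] -/
theorem mem_divLattice {I K : Submodule ℤ B} {x : B} : x ∈ divLattice I K p ↔ x ∈ I ∧ (p : ℤ) • x ∈ K := Iff.rfl

section Fibre

variable (hdiv : ∀ x : B, x ≠ 0 → IsUnit x) (hO : IsZOrder O) {e u v : B} (hmu : IsMatrixUnitsMod O p e u v)
  (hp : p.Prime) {I : Submodule ℤ B} (hI : IsInvertibleRightIdeal O I) {a : ℕ}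
  (K : Subideal O I (p ^ (a + 1) * p))

omit [Algebra ℚ B] [IsQuaternionAlgebra ℚ B] in
/-- `p^{2a+4} I ⊆ K` for `K ∈ Sub(I, p^{a+1} p)`. [folklore] -/
theorem Subideal.pow_smul_mem (hp : p.Prime) {x : B} (hx : x ∈ I) :
    ((p ^ (2 * a + 4) : ℕ) : ℤ) • x ∈ ((K.1 : invertibleRightIdeals O) : Submodule ℤ B) := by
  have _ := hp
  have h := relIndex_smul_mem (L := I) (L' := ((K.1 : invertibleRightIdeals O) : Submodule ℤ B)) hx
  have h2 : ((K.1 : invertibleRightIdeals O) : Submodule ℤ B).toAddSubgroup.relIndex I.toAddSubgroup = p ^ (2 * a + 4) :=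
    K.relIndex_eq.trans (by ring)
  rw [h2] at h
  exact_mod_cast h

include hI in
omit [Algebra ℚ B] [IsQuaternionAlgebra ℚ B] in
/-- The lattice pair `(L, K)`. [folklore] -/
theorem isLatticePair_divLattice :
    IsLatticePair O p (divLattice I ((K.1 : invertibleRightIdeals O) : Submodule ℤ B) p)
      ((K.1 : invertibleRightIdeals O) : Submodule ℤ B) where
  le x hx := mem_divLattice.mpr ⟨K.le hx, ((K.1 : invertibleRightIdeals O) : Submodule ℤ B).smul_mem _ hx⟩
  mul_mem_M x hx o ho := mem_divLattice.mpr ⟨hI.mul_mem (mem_divLattice.mp hx).1 ho, by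
    have := K.1.2.mul_mem (mem_divLattice.mp hx).2 ho
    rwa [smul_mul_assoc] at this⟩
  mul_mem_K x hx o ho := K.1.2.mul_mem hx ho
  smul_mem x hx := (mem_divLattice.mp hx).2

include hmu hp in
omit [Algebra ℚ B] [IsQuaternionAlgebra ℚ B] in
/-- **`p J ⊆ K` for every `J` in the fibre** (`K ⊆ J ⊆ I`, `[J : K] = p²`, `J` a right
`O`-lattice): `[J : K + pJ]` is a square dividing `p²`; it is not `1` (else `J = K + pJ = K` by
iteration), so it is `p²` and `K + p J = K`. [folklore] -/
theorem smul_le_of_relIndex_eq_sq {J Kl : Submodule ℤ B} (hKJ : Kl ≤ J) (hJO : ∀ x ∈ J, ∀ o ∈ O, x * o ∈ J)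
    (hKO : ∀ x ∈ Kl, ∀ o ∈ O, x * o ∈ Kl) (hidx : Kl.toAddSubgroup.relIndex J.toAddSubgroup = p ^ 2) :
    ∀ x ∈ J, (p : ℤ) • x ∈ Kl := by
  set K₁ : Submodule ℤ B := Kl ⊔ (p : ℤ) • J with hK₁
  have hpair : IsLatticePair O p J K₁ :=
    { le := sup_le hKJ (zsmul_le _ _)
      mul_mem_M := hJO
      mul_mem_K := fun x hx o ho => by
        obtain ⟨k, hk, b, hb, rfl⟩ := Submodule.mem_sup.mp hx
        obtain ⟨j, hj, rfl⟩ := (Submodule.mem_smul_pointwise_iff_exists _ _ J).mp hb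
        rw [add_mul, smul_mul_assoc]
        exact Submodule.add_mem _ (Submodule.mem_sup_left (hKO k hk o ho))
          (Submodule.mem_sup_right (Submodule.smul_mem_pointwise_smul _ _ J (hJO j hj o ho)))
      smul_mem := fun x hx => Submodule.mem_sup_right (Submodule.smul_mem_pointwise_smul _ _ J hx) }
  have hsq := relIndex_eq_corner_sq hmu hpair
  set s := Nat.card (IsMatrixUnitAction.corner (actE hmu hpair) (⊤ : AddSubgroup (LatQuot J K₁)))
  have hmul : Kl.toAddSubgroup.relIndex K₁.toAddSubgroup * K₁.toAddSubgroup.relIndex J.toAddSubgroup = p ^ 2 := by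
    rw [← hidx]
    exact AddSubgroup.relIndex_mul_relIndex _ _ _ (Submodule.toAddSubgroup_mono le_sup_left)
      (Submodule.toAddSubgroup_mono hpair.le)
  have hsdvd : s ∣ p := by
    have : s ^ 2 ∣ p ^ 2 := ⟨Kl.toAddSubgroup.relIndex K₁.toAddSubgroup, by rw [← hsq, ← hmul, mul_comm]⟩
    exact (Nat.pow_dvd_pow_iff two_ne_zero).mp this
  rcases (Nat.dvd_prime hp).mp hsdvd with hs1 | hsp
  · -- `[J : K₁] = 1`: `J = K₁`, then `J = K`, contradiction
    exfalso
    have hJK₁ : J ≤ K₁ := AddSubgroup.relIndex_eq_one.mp (by rw [hsq, hs1, one_pow])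
    have hJK : J ≤ Kl := fun x hx => by
      obtain ⟨k, hk, b, hb, rfl⟩ := Submodule.mem_sup.mp (hJK₁ hx)
      obtain ⟨j, hj, rfl⟩ := (Submodule.mem_smul_pointwise_iff_exists _ _ J).mp hb
      obtain ⟨k', hk', b', hb', rfl⟩ := Submodule.mem_sup.mp (hJK₁ hj)
      obtain ⟨j', hj', rfl⟩ := (Submodule.mem_smul_pointwise_iff_exists _ _ J).mp hb'
      refine Kl.add_mem hk ?_
      rw [smul_add, smul_smul]
      refine Kl.add_mem (Kl.smul_mem _ hk') ?_
      have h := relIndex_smul_mem (L := J) (L' := Kl) hj'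
      rw [hidx] at h
      rw [← pow_two]
      exact_mod_cast h
    have h1 : Kl.toAddSubgroup.relIndex J.toAddSubgroup = 1 := AddSubgroup.relIndex_eq_one.mpr
      (Submodule.toAddSubgroup_mono hJK)
    rw [hidx] at h1
    exact absurd h1 (by have := Nat.one_lt_pow two_ne_zero hp.one_lt; omega)
  · -- `[J : K₁] = p²`: `[K₁ : K] = 1`
    have h1 : Kl.toAddSubgroup.relIndex K₁.toAddSubgroup = 1 := by
      rw [hsq, hsp] at hmul
      exact Nat.eq_of_mul_eq_mul_right (pow_pos hp.pos 2) (by rw [hmul, one_mul])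
    have hK₁K : K₁ ≤ Kl := AddSubgroup.relIndex_eq_one.mp h1
    exact fun x hx => hK₁K (Submodule.mem_sup_right (Submodule.smul_mem_pointwise_smul _ _ J hx))

include hdiv hO hmu hp hI in
/-- **The fibre as a set of intermediate lattices**: `{J ∈ Sub(I, p^{a+1}) | K ⊆ J}` is in
bijection with the right `O`-lattices `J`, `K ⊆ J ⊆ L`, `[J : K] = p²`. [folklore] -/
def fibreEquivBetween :
    Fibre O I (p ^ (a + 1)) ((K.1 : invertibleRightIdeals O) : Submodule ℤ B) ≃
      {J : Submodule ℤ B // ((K.1 : invertibleRightIdeals O) : Submodule ℤ B) ≤ J ∧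
        J ≤ divLattice I ((K.1 : invertibleRightIdeals O) : Submodule ℤ B) p ∧
        (∀ x ∈ J, ∀ o ∈ O, x * o ∈ J) ∧
        ((K.1 : invertibleRightIdeals O) : Submodule ℤ B).toAddSubgroup.relIndex J.toAddSubgroup = p ^ 2} where
  toFun J :=
    have hidx : ((K.1 : invertibleRightIdeals O) : Submodule ℤ B).toAddSubgroup.relIndex
        ((J.1.1 : invertibleRightIdeals O) : Submodule ℤ B).toAddSubgroup = p ^ 2 :=
      relIndex_of_chain (pow_ne_zero _ hp.ne_zero) J.2 J.1.le J.1.relIndex_eq K.relIndex_eq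
    ⟨((J.1.1 : invertibleRightIdeals O) : Submodule ℤ B), J.2,
      fun x hx => ⟨J.1.le hx, smul_le_of_relIndex_eq_sq hmu hp J.2 (fun x hx o ho => J.1.1.2.mul_mem hx ho)
        (fun x hx o ho => K.1.2.mul_mem hx ho) hidx x hx⟩,
      fun x hx o ho => J.1.1.2.mul_mem hx ho, hidx⟩
  invFun J :=
    have hJI : J.1 ≤ I := fun x hx => (J.2.2.1 hx).1
    have hinv : IsInvertibleRightIdeal O J.1 :=
      hmu.isInvertibleRightIdeal_of_between hdiv hO hp hI hJI J.2.2.2.1 (n := 2 * a + 4)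
        fun x hx => J.2.1 (Subideal.pow_smul_mem K hp hx)
    ⟨⟨⟨J.1, hinv⟩, hJI, by
      have h := AddSubgroup.relIndex_mul_relIndex _ _ _ (Submodule.toAddSubgroup_mono J.2.1)
        (Submodule.toAddSubgroup_mono hJI)
      have hJ2 : ((K.1 : invertibleRightIdeals O) : Submodule ℤ B).toAddSubgroup.relIndex (J.1).toAddSubgroup = p ^ 2 :=
        J.2.2.2.2
      have h' : p ^ 2 * (J.1).toAddSubgroup.relIndex I.toAddSubgroup = p ^ 2 * (p ^ (a + 1)) ^ 2 :=
        calc p ^ 2 * (J.1).toAddSubgroup.relIndex I.toAddSubgroup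
            = ((K.1 : invertibleRightIdeals O) : Submodule ℤ B).toAddSubgroup.relIndex (J.1).toAddSubgroup *
                (J.1).toAddSubgroup.relIndex I.toAddSubgroup := by simp only [hJ2]
          _ = _ := h
          _ = (p ^ (a + 1) * p) ^ 2 := K.relIndex_eq
          _ = _ := by ring
      exact Nat.eq_of_mul_eq_mul_left (pow_pos hp.pos 2) h'⟩, J.2.1⟩
  left_inv J := by apply Subtype.ext; apply Subideal.ext; rfl
  right_inv J := by apply Subtype.ext; rfl

include hI hmu hp in
open Classical in
/-- **`[L : K] ∈ {p², p⁴}`, and `= p⁴` iff `K ⊆ p I`.** [folklore] -/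
theorem relIndex_divLattice_eq :
    ((K.1 : invertibleRightIdeals O) : Submodule ℤ B).toAddSubgroup.relIndex
        (divLattice I ((K.1 : invertibleRightIdeals O) : Submodule ℤ B) p).toAddSubgroup =
      if ((K.1 : invertibleRightIdeals O) : Submodule ℤ B) ≤ (p : ℤ) • I then p ^ 4 else p ^ 2 := by
  classical
  obtain ⟨w, hw⟩ := exists_units_eq_natCast (B := B) hp.ne_zero
  set Kl := ((K.1 : invertibleRightIdeals O) : Submodule ℤ B) with hKl
  set L := divLattice I Kl p with hL
  have hpair := isLatticePair_divLattice hI K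
  -- `L ≤ p⁻¹ K =: K'`
  set K' : Submodule ℤ B := w⁻¹ • Kl with hK'
  have hwx : ∀ x : B, ((w⁻¹⁻¹ : Bˣ) : B) * x = (p : ℤ) • x := fun x => by
    rw [inv_inv, hw, zsmul_eq_mul, Int.cast_natCast]
  have hmemK' : ∀ {x : B}, x ∈ K' ↔ (p : ℤ) • x ∈ Kl := fun {x} => by
    rw [hK', mem_units_smul_iff_mul_mem, hwx]
  have hLK' : L ≤ K' := fun x hx => hmemK'.mpr hx.2
  have hK'full : IsFullLattice B K' := K.1.2.isFullLattice.units_smul w⁻¹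
  have h4 : Kl.toAddSubgroup.relIndex K'.toAddSubgroup = p ^ 4 := by
    have := BrandtModule.relIndex_natCast_units_smul hK'full hw
    rwa [hK', smul_inv_smul] at this
  have hmul : Kl.toAddSubgroup.relIndex L.toAddSubgroup * L.toAddSubgroup.relIndex K'.toAddSubgroup = p ^ 4 := by
    rw [← h4]
    exact AddSubgroup.relIndex_mul_relIndex _ _ _ (Submodule.toAddSubgroup_mono hpair.le)
      (Submodule.toAddSubgroup_mono hLK')
  -- `[L : K]` is a square `s²` with `s ∣ p²`
  have hsq := relIndex_eq_corner_sq hmu hpair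
  set s := Nat.card (IsMatrixUnitAction.corner (actE hmu hpair) (⊤ : AddSubgroup (LatQuot L Kl)))
  have hs : s ∣ p ^ 2 := by
    have h : s ^ 2 ∣ (p ^ 2) ^ 2 :=
      ⟨L.toAddSubgroup.relIndex K'.toAddSubgroup, by rw [← hsq, hmul]; ring⟩
    exact (Nat.pow_dvd_pow_iff two_ne_zero).mp h
  obtain ⟨i, hi2, hi⟩ := (Nat.dvd_prime_pow hp).mp hs
  -- `[L : K] ≠ 1`: there is `x ∈ L ∖ K`
  have hne1 : Kl.toAddSubgroup.relIndex L.toAddSubgroup ≠ 1 := by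
    intro h1
    have hLK : L ≤ Kl := fun x hx => AddSubgroup.relIndex_eq_one.mp h1 (show x ∈ L.toAddSubgroup from hx)
    have hex : ∃ j : ℕ, ∀ x ∈ I, ((p ^ j : ℕ) : ℤ) • x ∈ Kl :=
      ⟨2 * a + 4, fun x hx => Subideal.pow_smul_mem K hp hx⟩
    have hspec := Nat.find_spec hex
    have hpos : Nat.find hex ≠ 0 := by
      intro h0
      rw [h0] at hspec
      have hIK : I ≤ Kl := fun x hx => by simpa using hspec x hx
      have h1' := AddSubgroup.relIndex_eq_one.mpr (Submodule.toAddSubgroup_mono hIK)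
      rw [K.relIndex_eq] at h1'
      have hlt : 1 < (p ^ (a + 1) * p) ^ 2 :=
        Nat.one_lt_pow two_ne_zero (Nat.one_lt_iff_ne_zero_and_ne_one.mpr
          ⟨mul_ne_zero (pow_ne_zero _ hp.ne_zero) hp.ne_zero, fun h =>
            hp.one_lt.ne' (Nat.eq_one_of_mul_eq_one_left h)⟩)
      omega
    obtain ⟨j, hj⟩ := Nat.exists_eq_succ_of_ne_zero hpos
    have hmin := Nat.find_min hex (show j < Nat.find hex by omega)
    push Not at hmin
    obtain ⟨x₀, hx₀I, hx₀K⟩ := hmin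
    have hxL : ((p ^ j : ℕ) : ℤ) • x₀ ∈ L := by
      refine ⟨I.smul_mem _ hx₀I, ?_⟩
      change (p : ℤ) • (((p ^ j : ℕ) : ℤ) • x₀) ∈ Kl
      have hcast : (p : ℤ) * ((p ^ j : ℕ) : ℤ) = ((p ^ Nat.find hex : ℕ) : ℤ) := by
        rw [hj, pow_succ']; push_cast; ring
      rw [smul_smul, hcast]
      exact hspec x₀ hx₀I
    exact hx₀K (hLK hxL)
  by_cases hKp : Kl ≤ (p : ℤ) • I
  · rw [if_pos hKp]
    have hK'I : K' ≤ I := by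
      have h : Kl ≤ w • I := by rw [units_smul_eq_natCast_smul hw]; exact hKp
      simpa [hK'] using units_smul_mono w⁻¹ h
    have hK'L : K' ≤ L := fun x hx => ⟨hK'I hx, hmemK'.mp hx⟩
    rw [show L = K' from le_antisymm hLK' hK'L, h4]
  · rw [if_neg hKp]
    have hne4 : Kl.toAddSubgroup.relIndex L.toAddSubgroup ≠ p ^ 4 := by
      intro h4'
      rw [h4'] at hmul
      have h1 : L.toAddSubgroup.relIndex K'.toAddSubgroup = 1 :=
        Nat.eq_of_mul_eq_mul_left (pow_pos hp.pos 4) (by rw [hmul, mul_one])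
      have hK'L : K' ≤ L := fun x hx => AddSubgroup.relIndex_eq_one.mp h1 (show x ∈ K'.toAddSubgroup from hx)
      apply hKp
      have hK'I : K' ≤ I := fun x hx => (hK'L hx).1
      have : Kl = w • K' := by rw [hK', smul_inv_smul]
      rw [this, ← units_smul_eq_natCast_smul hw]
      exact units_smul_mono w hK'I
    rw [hsq, hi, ← pow_mul] at hne1 hne4 ⊢
    interval_cases i
    · exact absurd (by ring) hne1
    · norm_num
    · exact absurd (by ring) hne4

include hdiv hO hmu hp hI in
/-- **The fibre count at a residually split prime, case `K ⊆ p I`: `p + 1`.** [cite: VignerasLNM800, Ch. III §5 exercice 5.8 (c) (N(p) = p)] -/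
theorem IsMatrixUnitsMod.card_fibre_of_le (hK : ((K.1 : invertibleRightIdeals O) : Submodule ℤ B) ≤ (p : ℤ) • I) :
    Nat.card (Fibre O I (p ^ (a + 1)) ((K.1 : invertibleRightIdeals O) : Submodule ℤ B)) = p + 1 := by
  have hidx := relIndex_divLattice_eq hmu hp hI K
  rw [if_pos hK] at hidx
  rw [Nat.card_congr (fibreEquivBetween hdiv hO hmu hp hI K)]
  exact card_between_eq_succ hmu (isLatticePair_divLattice hI K) hp hidx

include hdiv hO hmu hp hI in
/-- **The fibre count at a residually split prime, case `K ⊄ p I`: `1`.** [cite: VignerasLNM800, Ch. III §5 exercice 5.8 (c)] -/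
theorem IsMatrixUnitsMod.card_fibre_of_not_le (hK : ¬ ((K.1 : invertibleRightIdeals O) : Submodule ℤ B) ≤ (p : ℤ) • I) :
    Nat.card (Fibre O I (p ^ (a + 1)) ((K.1 : invertibleRightIdeals O) : Submodule ℤ B)) = 1 := by
  have hidx := relIndex_divLattice_eq hmu hp hI K
  rw [if_neg hK] at hidx
  rw [Nat.card_congr (fibreEquivBetween hdiv hO hmu hp hI K)]
  exact card_between_eq_one hmu (isLatticePair_divLattice hI K) hp hidx

end Fibre

end Literature.NumberTheory.Automorphic

end
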